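import Summits.Parity.GeneralizedHardyLittlewood.Theorems.PrimeLevelFamEdgeMomentsBeyondDiagonalDiagDecorOrderOneOnePoly
import HarnessLib

/-!
# Route `PrimeLevelFamEdge`, crux K_A `MomentsBeyondDiagonal` (stmt-Parity-20007), line «petersson_layers» v4, stub `stub_diag`:
# **the order-`(1,1)` Hecke-summed form SPLITS EXACTLY into the polynomial part (input of `…DecorOrderOneOnePoly`) and the
# remainder part (input of the corner pipeline)**

Census R3(ii), bridge item 5 of `Cruxes/MomentsBeyondDiagonal/Lines/petersson_layers_stub_diag_g10_blocks.md`. After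
`…DiagDecorOrderOneOneHecke.selbergOrderOneOne_hecke_eq` the order-`(1,1)` form is
`Sel(ττ·{X·c₀₀(y) + (L/2)(c₀₁(y) + c₁₀(y)) + c₁₁(y)})`, `y = g²k₁k₂/Q²`, `X = L²/4 − (P₂(k₁)+P₂(k₂))/4`,
`L = 2(log Q − log g) − log k₁ − log k₂ = log(1/y)`. With the polynomial parts of `…DiagBoseMixedStructure.bose_coeff_structure`
(`μ₀ = 1/4`, `…DiagDecorBoseMuZero`): `Π₀₀ = L/2 + E₀₀`, `Π₀₁ = −L²/8 + E₀₁`, `Π₁₀ = −L²/8 + E₁₀`, `Π₁₁ = L³/24 − 2μ₂L + E₁₁`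
(ANY reals `E_ab, μ₂`, ANY functions `c_ab` here), and `log Q = λ·log M`:

* `selbergOrderOneOne_split` — **`Sel(total) = Sel(poly) + Sel(rem)`** where `poly` is LITERALLY the weight of
  `…DecorOrderOneOnePoly.abs_selbergOrderOneOnePoly_sub_le` with `e₀₀ = E₀₀`, `e₀₁ = (E₀₁+E₁₀)/2 − 2μ₂`, `e₁₁ = E₁₁`
  (`L` written as `2λlog M − 2log g − log k₁ − log k₂`), and
  `rem = ττ·{X·r₀₀ + (L/2)(r₀₁ + r₁₀) + r₁₁}`, `r_ab = c_ab(y) − Π_ab(log(Q²/(g²k₁k₂)))` (the continued Bose remainders of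
  `…DiagCornerBoseRem`, evaluated at `y = g²k₁k₂/Q²`).

So the order-`(1,1)` target is reduced to ONE estimate: `Sel(rem) = O(1/log M)` at `M = q̂^{Δ′}`, `Q = q̂` (then
`…DecorOrderOneOnePoly` + `…DecorOrderTargetNormalize` close the order with `τ₁₁ := Δ′²(Φ₃/24 − Ψ₁/4)/(2(π²/6)²)·(π²/6)²`).
Def-free; theorems only. Helper `--supports stmt-Parity-20007`; closes nothing; K_A, K_B and the Parity summit are NOT proved;
nothing about Landau–Siegel zeros.

## References
* E. Kowalski, P. Michel, J. VanderKam, J. reine angew. Math. 526 (2000), (22)–(28) pp. 12–15.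
  [cite: KowalskiMichelVanderKam2000, (23)–(28) — derivation (polynomial/remainder split of the order-(1,1) diagonal weight)]
-/

noncomputable section

open scoped Real ArithmeticFunction.Moebius
open Finset ArithmeticFunction Polynomial

namespace Summit.Parity.GeneralizedHardyLittlewood.Theorems.MomentsBeyondDiagonal.DiagKernel

open Literature.NumberTheory.LFunctions Literature.NumberTheory.LFunctions.KMV2000

/-- `log(Q²/(g²k₁k₂)) = 2(log Q − log g) − log k₁ − log k₂` for `Q > 0`, `g, k₁, k₂ ≥ 1`. [folklore] -/
theorem log_Q_sq_div_eq {Q : ℝ} (hQ : 0 < Q) {g k₁ k₂ : ℕ} (hg : g ≠ 0) (hk₁ : k₁ ≠ 0) (hk₂ : k₂ ≠ 0) :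
    Real.log (Q ^ 2 / ((g * g * (k₁ * k₂) : ℕ) : ℝ)) = 2 * (Real.log Q - Real.log g) - Real.log k₁ - Real.log k₂ := by
  have hg' : (g : ℝ) ≠ 0 := by exact_mod_cast hg
  have h1 : (k₁ : ℝ) ≠ 0 := by exact_mod_cast hk₁
  have h2 : (k₂ : ℝ) ≠ 0 := by exact_mod_cast hk₂
  push_cast
  rw [Real.log_div (pow_ne_zero 2 hQ.ne') (by positivity), Real.log_pow, Real.log_mul (mul_ne_zero hg' hg')
    (mul_ne_zero h1 h2), Real.log_mul hg' hg', Real.log_mul h1 h2]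
  push_cast
  ring

/-- **The exact polynomial/remainder split of the order-`(1,1)` Hecke-summed Selberg form** (see the module docstring;
`Q > 0`, `log Q = λ·log M`, any reals `E₀₀ E₀₁ E₁₀ E₁₁ μ₂`, any functions `c₀₀ c₀₁ c₁₀ c₁₁`).
[cite: KowalskiMichelVanderKam2000, (23)–(28) — derivation] -/
theorem selbergOrderOneOne_split (P : ℝ[X]) (M : ℝ) {Q lam : ℝ} (hQ : 0 < Q) (hlam : Real.log Q = lam * Real.log M)
    (c₀₀ c₀₁ c₁₀ c₁₁ : ℝ → ℝ) (E₀₀ E₀₁ E₁₀ E₁₁ μ₂ : ℝ) :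
    ∑ c ∈ Icc 1 ⌊M⌋₊, ∑ g ∈ Icc 1 (⌊M⌋₊ / c), (μ g : ℝ) * c *
        ∑ k₁ ∈ Icc 1 (⌊M⌋₊ / (c * g)), ∑ k₂ ∈ Icc 1 (⌊M⌋₊ / (c * g)),
          ((μ (c * g * k₁) : ℝ) * ((psi (c * g * k₁))⁻¹ *
              P.eval (Real.log (M / ((c * g * k₁ : ℕ) : ℝ)) / Real.log M))) / ((c * g * k₁ : ℕ) : ℝ) *
            (((μ (c * g * k₂) : ℝ) * ((psi (c * g * k₂))⁻¹ *
              P.eval (Real.log (M / ((c * g * k₂ : ℕ) : ℝ)) / Real.log M))) / ((c * g * k₂ : ℕ) : ℝ)) *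
            ((k₁.divisors.card : ℝ) * (k₂.divisors.card : ℝ) *
              (((2 * (Real.log Q - Real.log g) - Real.log k₁ - Real.log k₂) ^ 2 / 4 -
                  ((∑ p ∈ k₁.primeFactors, Real.log p ^ 2) + ∑ p ∈ k₂.primeFactors, Real.log p ^ 2) / 4) *
                c₀₀ (((g * g * (k₁ * k₂) : ℕ) : ℝ) / Q ^ 2) +
              (2 * (Real.log Q - Real.log g) - Real.log k₁ - Real.log k₂) / 2 *
                (c₀₁ (((g * g * (k₁ * k₂) : ℕ) : ℝ) / Q ^ 2) + c₁₀ (((g * g * (k₁ * k₂) : ℕ) : ℝ) / Q ^ 2)) +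
              c₁₁ (((g * g * (k₁ * k₂) : ℕ) : ℝ) / Q ^ 2))) =
      ∑ c ∈ Icc 1 ⌊M⌋₊, ∑ g ∈ Icc 1 (⌊M⌋₊ / c), (μ g : ℝ) * c *
        ∑ k₁ ∈ Icc 1 (⌊M⌋₊ / (c * g)), ∑ k₂ ∈ Icc 1 (⌊M⌋₊ / (c * g)),
          ((μ (c * g * k₁) : ℝ) * ((psi (c * g * k₁))⁻¹ *
              P.eval (Real.log (M / ((c * g * k₁ : ℕ) : ℝ)) / Real.log M))) / ((c * g * k₁ : ℕ) : ℝ) *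
            (((μ (c * g * k₂) : ℝ) * ((psi (c * g * k₂))⁻¹ *
              P.eval (Real.log (M / ((c * g * k₂ : ℕ) : ℝ)) / Real.log M))) / ((c * g * k₂ : ℕ) : ℝ)) *
            (1 / 24 * ((k₁.divisors.card : ℝ) * (k₂.divisors.card : ℝ) *
                (2 * (lam * Real.log M) - 2 * Real.log g - Real.log k₁ - Real.log k₂) ^ 3) +
              E₀₀ / 4 * ((k₁.divisors.card : ℝ) * (k₂.divisors.card : ℝ) *
                (2 * (lam * Real.log M) - 2 * Real.log g - Real.log k₁ - Real.log k₂) ^ 2) +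
              ((E₀₁ + E₁₀) / 2 - 2 * μ₂) * ((k₁.divisors.card : ℝ) * (k₂.divisors.card : ℝ) *
                (2 * (lam * Real.log M) - 2 * Real.log g - Real.log k₁ - Real.log k₂) ^ 1) +
              E₁₁ * ((k₁.divisors.card : ℝ) * (k₂.divisors.card : ℝ) *
                (2 * (lam * Real.log M) - 2 * Real.log g - Real.log k₁ - Real.log k₂) ^ 0) -
              1 / 8 * ((k₁.divisors.card : ℝ) * (∑ p ∈ k₁.primeFactors, Real.log p ^ 2) * (k₂.divisors.card : ℝ) *
                (2 * (lam * Real.log M) - 2 * Real.log g - Real.log k₁ - Real.log k₂) ^ 1) -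
              1 / 8 * ((k₁.divisors.card : ℝ) * ((k₂.divisors.card : ℝ) * ∑ p ∈ k₂.primeFactors, Real.log p ^ 2) *
                (2 * (lam * Real.log M) - 2 * Real.log g - Real.log k₁ - Real.log k₂) ^ 1) -
              E₀₀ / 4 * ((k₁.divisors.card : ℝ) * (∑ p ∈ k₁.primeFactors, Real.log p ^ 2) * (k₂.divisors.card : ℝ) *
                (2 * (lam * Real.log M) - 2 * Real.log g - Real.log k₁ - Real.log k₂) ^ 0) -
              E₀₀ / 4 * ((k₁.divisors.card : ℝ) * ((k₂.divisors.card : ℝ) * ∑ p ∈ k₂.primeFactors, Real.log p ^ 2) *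
                (2 * (lam * Real.log M) - 2 * Real.log g - Real.log k₁ - Real.log k₂) ^ 0)) +
      ∑ c ∈ Icc 1 ⌊M⌋₊, ∑ g ∈ Icc 1 (⌊M⌋₊ / c), (μ g : ℝ) * c *
        ∑ k₁ ∈ Icc 1 (⌊M⌋₊ / (c * g)), ∑ k₂ ∈ Icc 1 (⌊M⌋₊ / (c * g)),
          ((μ (c * g * k₁) : ℝ) * ((psi (c * g * k₁))⁻¹ *
              P.eval (Real.log (M / ((c * g * k₁ : ℕ) : ℝ)) / Real.log M))) / ((c * g * k₁ : ℕ) : ℝ) *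
            (((μ (c * g * k₂) : ℝ) * ((psi (c * g * k₂))⁻¹ *
              P.eval (Real.log (M / ((c * g * k₂ : ℕ) : ℝ)) / Real.log M))) / ((c * g * k₂ : ℕ) : ℝ)) *
            ((k₁.divisors.card : ℝ) * (k₂.divisors.card : ℝ) *
              (((2 * (Real.log Q - Real.log g) - Real.log k₁ - Real.log k₂) ^ 2 / 4 -
                  ((∑ p ∈ k₁.primeFactors, Real.log p ^ 2) + ∑ p ∈ k₂.primeFactors, Real.log p ^ 2) / 4) *
                (c₀₀ (((g * g * (k₁ * k₂) : ℕ) : ℝ) / Q ^ 2) -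
                  (Real.log (Q ^ 2 / ((g * g * (k₁ * k₂) : ℕ) : ℝ)) / 2 + E₀₀)) +
              (2 * (Real.log Q - Real.log g) - Real.log k₁ - Real.log k₂) / 2 *
                ((c₀₁ (((g * g * (k₁ * k₂) : ℕ) : ℝ) / Q ^ 2) -
                    (-(Real.log (Q ^ 2 / ((g * g * (k₁ * k₂) : ℕ) : ℝ)) ^ 2) / 8 + E₀₁)) +
                  (c₁₀ (((g * g * (k₁ * k₂) : ℕ) : ℝ) / Q ^ 2) -
                    (-(Real.log (Q ^ 2 / ((g * g * (k₁ * k₂) : ℕ) : ℝ)) ^ 2) / 8 + E₁₀))) +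
              (c₁₁ (((g * g * (k₁ * k₂) : ℕ) : ℝ) / Q ^ 2) -
                (Real.log (Q ^ 2 / ((g * g * (k₁ * k₂) : ℕ) : ℝ)) ^ 3 / 24 -
                  2 * μ₂ * Real.log (Q ^ 2 / ((g * g * (k₁ * k₂) : ℕ) : ℝ)) + E₁₁)))) := by
  rw [← selbergProd_add]
  refine Finset.sum_congr rfl fun c _ ↦ Finset.sum_congr rfl fun g hg ↦ ?_
  have hg0 : g ≠ 0 := by have := (Finset.mem_Icc.1 hg).1; omega
  congr 1
  refine Finset.sum_congr rfl fun k₁ hk₁ ↦ Finset.sum_congr rfl fun k₂ hk₂ ↦ ?_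
  have hk₁0 : k₁ ≠ 0 := by have := (Finset.mem_Icc.1 hk₁).1; omega
  have hk₂0 : k₂ ≠ 0 := by have := (Finset.mem_Icc.1 hk₂).1; omega
  rw [log_Q_sq_div_eq hQ hg0 hk₁0 hk₂0, hlam]
  ring

end Summit.Parity.GeneralizedHardyLittlewood.Theorems.MomentsBeyondDiagonal.DiagKernel

end
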